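import Literature.NumberTheory.EllipticCurves.HeegnerPoints
import Literature.NumberTheory.EllipticCurves.Isogeny
import HarnessLib

set_option linter.dupNamespace false -- `Summit.BirchSwinnertonDyer.BirchSwinnertonDyer.Theorems.…` (summit = sub)
set_option autoImplicit false

/-!
# Route `BiquadraticEisensteinDescent` — DEFINITIONS (D-0017 `Theorems/<RouteSlug><Topic>Defs.lean`, reviewed):
# the objects of the crux idea `disjoint-divisibility-pigeonhole` (crux `HeegnerTwistCouplingInSupply`, stmt-BirchSwinnertonDyer-21381)

Cell `pub/bsd-wall`, width-prover seat `bsd-wall-cm-bed-w4` g24 (explicit-unit), route `BiquadraticEisensteinDescent`, crux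
stmt-BirchSwinnertonDyer-21381 `HeegnerTwistCouplingInSupply`; serves the crux idea card
`Cruxes/HeegnerTwistCouplingInSupply/Ideas/disjoint-divisibility-pigeonhole.md` (cruxidea seat 1 g24, 2026-08-29) by typing its
objects in the `Theorems` tree VERBATIM from the card's sketch `Cruxes/HeegnerTwistCouplingInSupply/SketchIdeasSeatOneG24.lean`
(which is not importable from `Theorems`), so that the card's glue (its declared first stub `pigeonholeTransferShape`, its
exceptional-set count, and its «Transfer» composition) can be PROVED in the companion file
`…HeegnerTwistCouplingInSupplyDisjointDivisibility.lean` (namespace `…Theorems.DisjointDivisibility`).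

The card (a line PROPOSAL for the crux, not a registered line): for a CM corner curve `W` of conductor `N_W = N₀p²`
(`p ≥ 5` CM-inert, additive) the crux asks for ONE imaginary quadratic `K = ℚ(√d)`, `|d| > 4`, Heegner for `N_W`, with
`L(W^{(d)}, 1) ≠ 0` AND `p ∤ h(d)`. Lever: inside the `p`-INDEPENDENT ambient set `A₀(Y)` of Heegner discriminants for the
twist-core level `N₀` below `Y`, the divisibility classes `{d : p ∣ h(d)}` for the primes `p` of one dyadic block `[P, 2P]` are
almost disjoint (`h(d) ≤ |d| ≤ Y` has at most `log Y / log P` prime factors `≥ P`), so at most `(log Y/log P)/τ` primes of the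
block are `τ`-POPULAR; for a non-popular `p`, an effective LEVEL-UNIFORM non-vanishing count (S1, the L-side input — NOT in
print in this uniformity) gives the crux conclusion by pigeonhole inside `A_{N_W}(Y) ⊆ A₀(Y)`, granted that a fixed fraction
of `A₀(Y)` survives the extra Heegner condition at `p` (S3, the card's «Pólya–Vinogradov» step, typed here as an input).

* `IsHeegnerDisc N d`, `IsDivisibleDisc p d`, `IsCouplingDisc W p d` (= the crux conclusion realised at `d`), `ambient N Y`,
  `divisibleIn N Y p`, `nonvanishingIn W N Y`, `Popular N₀ Y p τ` — the discriminant-indexed objects (sketch, verbatim);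
* `LevelUniformNonvanishingCount A B` — S1 (sketch, verbatim); `pigeonholeTransferShape A B` — the card's declared FIRST
  STUB (sketch, verbatim; PROVED for every `A, B` in the companion file);
* `HeegnerSplitDensity A c` — S3, the card's step «`|A_{N_W}(Y)| ≥ |A₀(Y)|/3`» as a typed input with free constant `c`
  and height exponent `A` (this seat; elementary squarefree counting in progressions in truth, not proved here);
* `AlmostAllPrimesShape A B c` — the card's headline theorem-shape «all but `c·(log Y/log P)·(log Y)^B` primes of the block»
  (this seat's typing of the card's prose, with the constant `c` of S3 = `1/τ·(log Y)^{-B}` kept explicit and the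
  non-emptiness of the ambient set made a hypothesis — see the companion file for why both are needed; PROVED there from
  S1 ∧ S3).

The sketch's own `exceptionalSetShape` and `almostAllPrimesShape` are NOT re-declared: the former is false as typed when the
ambient set is empty (every prime is then vacuously popular; refuted by value in the companion file) and the latter omits the
S3 constant; their corrected forms are the companion file's `card_popular_le` / `AlmostAllPrimesShape`.

DEFINITIONS ONLY; no theorem, no named fact, no `sorry`, no instance, no notation. Nothing here asserts anything about
`L`-values, class numbers, the crux or BSD; BSD is not proved by any of this and stmt-21381 is not closed. Junk values
(documented): `ambient N Y` lists `d ∈ [−Y, −5]`, so it is empty for `Y < 5`; `Popular N₀ Y p τ` is vacuously true on an empty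
ambient set; `x / (Real.log Y)^B` is Lean's `x / 0 = 0` when `Y ≤ 1`.

References: the card and sketch above; W. Kohnen, K. Ono, Invent. Math. 135 (1999) (indivisibility of class numbers and
rank-zero twists, separately); J. Hoffstein, A. Kontorovich, arXiv:1008.0839 (first non-vanishing quadratic twist); X. Li,
Invent. Math. (2024) = arXiv:2208.07343 (second moment of quadratic twists) — the print the card leans on for S1, none used here.
-/

noncomputable section

open scoped Classical

open Literature.NumberTheory.EllipticCurves

namespace Summit.BirchSwinnertonDyer.BirchSwinnertonDyer.Theorems.DisjointDivisibility

/-- `d` is the discriminant of an imaginary quadratic field with `|d| > 4` satisfying the Heegner hypothesis for `N`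
(every prime of `N` splits). Sketch `SketchIdeasSeatOneG24.lean` (verbatim). -/
def IsHeegnerDisc (N : ℕ) (d : ℤ) : Prop :=
  ∃ (K : Type) (_ : Field K) (_ : NumberField K),
    IsImaginaryQuadratic K ∧ NumberField.discr K = d ∧ 4 < d.natAbs ∧ SatisfiesHeegnerHypothesis N K

/-- `p` divides the class number of the imaginary quadratic field of discriminant `d`.
Sketch `SketchIdeasSeatOneG24.lean` (verbatim). -/
def IsDivisibleDisc (p : ℕ) (d : ℤ) : Prop :=
  ∃ (K : Type) (_ : Field K) (_ : NumberField K),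
    IsImaginaryQuadratic K ∧ NumberField.discr K = d ∧ p ∣ NumberField.classNumber K

/-- The crux conclusion of `HeegnerTwistCouplingInSupply` for `(W, p)` realised at the discriminant `d`: an imaginary
quadratic `K` of discriminant `d`, `|d| > 4`, Heegner for `N_W`, with `L(W^{(d)}, 1) ≠ 0` and `p ∤ h_K`.
Sketch `SketchIdeasSeatOneG24.lean` (verbatim). -/
def IsCouplingDisc (W : WeierstrassCurve ℚ) [W.IsElliptic] (p : ℕ) (d : ℤ) : Prop :=
  ∃ (K : Type) (_ : Field K) (_ : NumberField K),
    IsImaginaryQuadratic K ∧ NumberField.discr K = d ∧ 4 < d.natAbs ∧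
    SatisfiesHeegnerHypothesis (W.conductorNorm ℤ) K ∧
    (W.quadraticTwist (d : ℚ)).entireLFunction 1 ≠ 0 ∧ ¬ p ∣ NumberField.classNumber K

/-- Ambient set `A_N(Y)`: Heegner discriminants for `N` with `|d| ≤ Y` (as a finset of `d ∈ [−Y, −5]`; empty for `Y < 5`).
Sketch `SketchIdeasSeatOneG24.lean` (verbatim). -/
def ambient (N Y : ℕ) : Finset ℤ :=
  (Finset.Icc (-(Y : ℤ)) (-5)).filter (fun d => IsHeegnerDisc N d)

/-- `S_p ∩ A_N(Y)`: the `p`-divisible members of the ambient set. Sketch `SketchIdeasSeatOneG24.lean` (verbatim). -/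
def divisibleIn (N Y p : ℕ) : Finset ℤ :=
  (ambient N Y).filter (fun d => IsDivisibleDisc p d)

/-- Non-vanishing members of `A_N(Y)` for the curve `W` (`N` will be `W.conductorNorm ℤ`).
Sketch `SketchIdeasSeatOneG24.lean` (verbatim). -/
def nonvanishingIn (W : WeierstrassCurve ℚ) [W.IsElliptic] (N Y : ℕ) : Finset ℤ :=
  (ambient N Y).filter (fun d => (W.quadraticTwist (d : ℚ)).entireLFunction 1 ≠ 0)

/-- `p` is `τ`-POPULAR at height `Y` for the twist-core level `N₀`: at least a `τ`-fraction of the ambient Heegner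
discriminants for `N₀` below `Y` have `p ∣ h(d)` (Cohen–Lenstra predicts the fraction `≈ 1/p`; `¬ Popular` for the GIVEN `p`
is the h-side residual of the card). Vacuously true when `ambient N₀ Y = ∅`. Sketch `SketchIdeasSeatOneG24.lean` (verbatim). -/
def Popular (N₀ Y p : ℕ) (τ : ℝ) : Prop :=
  τ * ((ambient N₀ Y).card : ℝ) ≤ ((divisibleIn N₀ Y p).card : ℝ)

/-- S1 — the card's L-side input (NOT in print level-uniformly; a typed INPUT, not asserted): there are `A, B` such that for
every CM curve `W` of analytic rank one and conductor `N` and every `Y ≥ N^A`, at least a `(log Y)^{-B}`-fraction of the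
Heegner discriminants for `N` below `Y` are non-vanishing twists. Sketch `SketchIdeasSeatOneG24.lean` (verbatim). -/
def LevelUniformNonvanishingCount (A B : ℕ) : Prop :=
  ∀ (W : WeierstrassCurve ℚ) [W.IsElliptic] [W.IsGloballyMinimal] [NeZero (W.conductorNorm ℤ)],
    W.HasCM → W.analyticRank = 1 →
    ∀ Y : ℕ, (W.conductorNorm ℤ) ^ A ≤ Y →
      ((ambient (W.conductorNorm ℤ) Y).card : ℝ) / (Real.log Y) ^ B
        ≤ ((nonvanishingIn W (W.conductorNorm ℤ) Y).card : ℝ)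

/-- The pigeonhole transfer — the card's declared FIRST STUB (shape of the line's composition): S1, a height where it applies,
a twist-core level `N₀` with `ambient N Y ⊆ ambient N₀ Y` and the strict count `#divisibleIn N₀ Y p < #ambient N Y/(log Y)^B`
yield a coupling discriminant. Sketch `SketchIdeasSeatOneG24.lean` (verbatim); PROVED for all `A, B` in the companion file. -/
def pigeonholeTransferShape (A B : ℕ) : Prop :=
  LevelUniformNonvanishingCount A B →
  ∀ (W : WeierstrassCurve ℚ) [W.IsElliptic] [W.IsGloballyMinimal] [NeZero (W.conductorNorm ℤ)]
    (p N₀ Y : ℕ), W.HasCM → W.analyticRank = 1 → (W.conductorNorm ℤ) ^ A ≤ Y →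
    (∀ d ∈ ambient (W.conductorNorm ℤ) Y, d ∈ ambient N₀ Y) →
    ((divisibleIn N₀ Y p).card : ℝ) < ((ambient (W.conductorNorm ℤ) Y).card : ℝ) / (Real.log Y) ^ B →
    ∃ d : ℤ, IsCouplingDisc W p d

/-- S3 — the card's density step «`|A_{N₀p²}(Y)| ≥ |A₀(Y)|/c`» as a typed INPUT (not asserted): at every height
`Y ≥ (N₀p²)^A`, at most a `c`-multiple of the Heegner discriminants for `N₀` below `Y` is lost to the one extra splitting
condition at the prime `p` (in truth elementary squarefree counting in progressions modulo `4N₀p` for `A ≥ 2` and large `c`;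
the card invokes Pólya–Vinogradov). This seat's typing of the card's «Transfer» paragraph. -/
def HeegnerSplitDensity (A : ℕ) (c : ℝ) : Prop :=
  ∀ (N₀ p Y : ℕ), p.Prime → 0 < N₀ → (N₀ * p ^ 2) ^ A ≤ Y →
    ((ambient N₀ Y).card : ℝ) ≤ c * ((ambient (N₀ * p ^ 2) Y).card : ℝ)

/-- The card's headline theorem-shape, corrected (this seat's typing of the card's prose «all CM-inert corner primes
`p ∈ [P, 2P]` except at most `c·(log Y)^B·(log Y/log P)` of them, `Y = (N₀(2P)²)^A`, satisfy the crux conclusion for every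
corner curve `W` of conductor `N₀p²`»): for a fixed twist-core level `N₀ > 0` whose ambient Heegner set at height `Y` is
non-empty, an exceptional set `E` of that size outside which every CM curve of analytic rank one and conductor `N₀p²` admits a
coupling discriminant. The sketch's `almostAllPrimesShape` omits the constant `c` and the non-emptiness; PROVED from
`LevelUniformNonvanishingCount A B ∧ HeegnerSplitDensity A c` in the companion file. -/
def AlmostAllPrimesShape (A B : ℕ) (c : ℝ) : Prop :=
  ∀ (N₀ P : ℕ), 2 ≤ P → 0 < N₀ → (ambient N₀ ((N₀ * (2 * P) ^ 2) ^ A)).Nonempty →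
    ∃ E : Finset ℕ,
      (E.card : ℝ) ≤ c * (Real.log ((N₀ * (2 * P) ^ 2) ^ A : ℕ) / Real.log P) *
          (Real.log ((N₀ * (2 * P) ^ 2) ^ A : ℕ)) ^ B ∧
      ∀ (W : WeierstrassCurve ℚ) [W.IsElliptic] [W.IsGloballyMinimal] [NeZero (W.conductorNorm ℤ)]
        (p : ℕ) [Fact p.Prime], W.HasCM → W.analyticRank = 1 → P ≤ p → p ≤ 2 * P → p ∉ E →
        W.conductorNorm ℤ = N₀ * p ^ 2 → ∃ d : ℤ, IsCouplingDisc W p d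

end Summit.BirchSwinnertonDyer.BirchSwinnertonDyer.Theorems.DisjointDivisibility

end
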